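import Summits.CriticalPhenomena.PercolationContinuityZ3.Theorems.Transplant.SkelPhiRootBridgeGeom
import Summits.CriticalPhenomena.PercolationContinuityZ3.Theorems.Transplant.TwoAxisParaCells
import HarnessLib

/-!
# N1 ({±1} node), (F) inner route, part R5b-iv (hp-8 g33): **EXACT CELL READINGS OF STRIDE DISPLACEMENTS** — the backbone of the per-centre
# arithmetic.  When the resolutions are multiples of `A` (`c₀ = A·κ₀`, `c₁ = A·κ₁`, true for the ledger's fine cells) and `D = A²·mod`:
# a `u`-stride `m·(n, h)` shifts the coarse `λ₀`-coordinate by EXACTLY `κ₀·m` and leaves `λ₁` unchanged; a `v`-offset `m·(vα, vβ)` shifts the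
# coarse `λ₁`-coordinate by exactly `κ₁·m` and leaves `λ₀` unchanged (`coarse c s D (λ + t) = coarse c s D λ + q` whenever `c·t = D·q`).
builds on p205010 (kernel theorem, internal audit signed; external expert review pending) — nothing in this file uses p205010; no claim about the open node.
Lane `prim-bschramm`, seat `prim-hp-8` (gen 33); helper file (`--supports stmt-CriticalPhenomena-4575 --as helper`).
* `TwoAxis.Para.coarse_add_of_mul_eq`, `lam0_add_smul_u`, `lam1_add_smul_u`, `lam0_add_smul_v`, `lam1_add_smul_v`,
  **`coarse_lam0_add_smul_u`**, **`coarse_lam1_add_smul_u`**, **`coarse_lam0_add_smul_v`**, **`coarse_lam1_add_smul_v`**.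
[cite: MartineauTassion2017, §4.1 (the lattice generated by u, v)] [cite: Timar2007, Lemma 2.2, p. 3]
-/

namespace Summit.CriticalPhenomena.PercolationContinuityZ3.Theorems.Transplant

namespace TwoAxis.Para

open Literature.Probability.LatticeModels
open Skelφ (pt pt_zero pt_one)

/-- `coarse c s D (t + t') = coarse c s D t + q` whenever `c·t' = D·q` (`D ≠ 0`). [folklore] -/
theorem coarse_add_of_mul_eq {c s D t t' q : ℤ} (hD : D ≠ 0) (h : c * t' = D * q) : coarse c s D (t + t') = coarse c s D t + q := by
  unfold coarse
  have e : c * (t + t') + s = (c * t + s) + q * D := by rw [mul_add, h]; ring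
  rw [e, Int.add_mul_ediv_right _ _ hD]

/-- `λ₀` after a `u`-stride: `λ₀(y + m·(n,h)) = λ₀(y) + A·m·mod`. [folklore] -/
theorem lam0_add_smul_u (A n h vα vβ m : ℤ) (y : Site 2) :
    lam0 A vα vβ (y + m • pt n h) = lam0 A vα vβ y + A * m * modulus n h vα vβ := by
  simp only [lam0, modulus, Pi.add_apply, Pi.smul_apply, smul_eq_mul, pt_zero, pt_one]; ring

/-- `λ₁` is invariant under `u`-strides: `λ₁(y + m·(n,h)) = λ₁(y)`. [folklore] -/
theorem lam1_add_smul_u (A n h m : ℤ) (y : Site 2) : lam1 A n h (y + m • pt n h) = lam1 A n h y := by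
  simp only [lam1, bp, Pi.add_apply, Pi.smul_apply, smul_eq_mul, pt_zero, pt_one]; ring

/-- `λ₀` is invariant under `v`-offsets: `λ₀(y + m·(vα,vβ)) = λ₀(y)`. [folklore] -/
theorem lam0_add_smul_v (A vα vβ m : ℤ) (y : Site 2) : lam0 A vα vβ (y + m • pt vα vβ) = lam0 A vα vβ y := by
  simp only [lam0, Pi.add_apply, Pi.smul_apply, smul_eq_mul, pt_zero, pt_one]; ring

/-- `λ₁` after a `v`-offset: `λ₁(y + m·(vα,vβ)) = λ₁(y) + A·m·mod`. [folklore] -/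
theorem lam1_add_smul_v (A n h vα vβ m : ℤ) (y : Site 2) :
    lam1 A n h (y + m • pt vα vβ) = lam1 A n h y + A * m * modulus n h vα vβ := by
  simp only [lam1, bp, modulus, Pi.add_apply, Pi.smul_apply, smul_eq_mul, pt_zero, pt_one]; ring

/-- **A `u`-stride reads exactly `κ₀` cells on axis `0`** (`c₀ = A·κ₀`, `D = A²·mod ≠ 0`). [cite: MartineauTassion2017, §4.1] -/
theorem coarse_lam0_add_smul_u {A n h vα vβ c₀ s D κ₀ : ℤ} (hc : c₀ = A * κ₀) (hD : D = detD A n h vα vβ) (hD0 : D ≠ 0) (m : ℤ)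
    (y : Site 2) : coarse c₀ s D (lam0 A vα vβ (y + m • pt n h)) = coarse c₀ s D (lam0 A vα vβ y) + κ₀ * m := by
  rw [lam0_add_smul_u]
  refine coarse_add_of_mul_eq hD0 ?_
  rw [hc, hD, detD]; ring

/-- **A `u`-stride reads exactly `0` cells on axis `1`**. [folklore] -/
theorem coarse_lam1_add_smul_u (A n h c₁ s D m : ℤ) (y : Site 2) :
    coarse c₁ s D (lam1 A n h (y + m • pt n h)) = coarse c₁ s D (lam1 A n h y) := by
  rw [lam1_add_smul_u]

/-- **A `v`-offset reads exactly `0` cells on axis `0`**. [folklore] -/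
theorem coarse_lam0_add_smul_v (A vα vβ c₀ s D m : ℤ) (y : Site 2) :
    coarse c₀ s D (lam0 A vα vβ (y + m • pt vα vβ)) = coarse c₀ s D (lam0 A vα vβ y) := by
  rw [lam0_add_smul_v]

/-- **A `v`-offset reads exactly `κ₁` cells on axis `1`** (`c₁ = A·κ₁`, `D = A²·mod ≠ 0`). [cite: MartineauTassion2017, §4.1] -/
theorem coarse_lam1_add_smul_v {A n h vα vβ c₁ s D κ₁ : ℤ} (hc : c₁ = A * κ₁) (hD : D = detD A n h vα vβ) (hD0 : D ≠ 0) (m : ℤ)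
    (y : Site 2) : coarse c₁ s D (lam1 A n h (y + m • pt vα vβ)) = coarse c₁ s D (lam1 A n h y) + κ₁ * m := by
  rw [lam1_add_smul_v]
  refine coarse_add_of_mul_eq hD0 ?_
  rw [hc, hD, detD]; ring

end TwoAxis.Para

end Summit.CriticalPhenomena.PercolationContinuityZ3.Theorems.Transplant
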